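import Literature.Analysis.FluidPDE.LocalTypeI
import HarnessLib

/-!
# Morrey-type estimates: bounded scaled energies imply Type I bounds (Albritton–Barker 2019, Lemma 2.6)

Analysis/FluidPDE named-fact file, companion of `LocalTypeI.lean` and `LocalTypeIWeakSerrin.lean`
(same paper, same vocabulary). D. Albritton, T. Barker, *On local Type I singularities of the
Navier–Stokes equations and Liouville theorems*, J. Math. Fluid Mech. 21 (2019) = arXiv:1811.00502
(held: paper:arxiv-1811.00502; §1 and §2 read, materialised chunks p0003, p0006). Bib key
`AlbrittonBarker2019`.

**Lemma 2.6** (Morrey-type estimates; verbatim, chunk p0006): "Suppose `(v,q)` is a suitable weak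
solution in `Q` with
`min_{s,l} { sup_{Q' ⊂ Q} A(Q'), sup_{Q' ⊂ Q} C(Q'), sup_{Q' ⊂ Q} E(Q'), sup_{Q' ⊂ Q} M^{s,l}(Q') } < ∞`,
where `s > 3/2`, `l > 1` are finite and required to satisfy `3/s + 2/l < 2`. Then, for all
`Q' = Q(R)` with `0 < R < 1`, `𝐈(Q') < ∞`." Preceded by: "The next lemma asserts that finiteness of
rescaled energies `A, C, E` (see [Seregin 2006]) or critical Morrey-type quantities `M^{s,l}` (see
[Seregin–Šverák handbook] and [Seregin–Zajaczkowski 2006]) implies Type I bounds for suitable weak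
solutions", and followed by: "For the above result to hold, it is crucial that `(v,q)` is already
assumed to be suitable, since the proof relies on the local energy inequality. Indeed, the estimate
which gives (𝐈 bound) depends on the background quantities `C(1)` and `D(1)`." Notation (§1, chunk
p0003, and §2): `Q(z,r) = B(x,r) × ]t − r², t[`, `Q(r) = Q(0,r)`, `Q = Q(1)`;
`A(Q') = esssup_{t−r²<t'<t} r⁻¹ ∫_{B(x,r)} |v|²`, `C(Q') = r⁻² ∫_{Q'} |v|³`,
`D(Q') = r⁻² ∫_{Q'} |q − [q]_{x,r}|^{3/2}`, `E(Q') = r⁻¹ ∫_{Q'} |∇v|²`,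
`𝐈(ω) = sup_{Q' ⊂ ω} (A + C + D + E)(Q')`; suitable weak solutions are those of Def. 2.1.

**Vendored** as `albrittonBarker2019_lemma_2_6`: the three RESCALED-ENERGY cases of the minimum
(`A`, `C` or `E` bounded over all parabolic sub-balls of the unit ball) for a suitable weak solution
in `Q(z, 1)` (tree: `IsSuitableWeakSolutionInBall 1 z u p`, A–B Def. 2.1; `A` with the essential
supremum `cknAEss`, `C = FluidPDE.cknC`, `E = FluidPDE.cknE` evaluated on a weak spatial gradient `G`
of `u`, exactly the summands of the tree's `𝐈 = typeIBound`); conclusion: for every `0 < R < 1`,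
`typeIBound (Q(z,R)) u p G < ⊤`. "min{…} < ∞" is rendered as a disjunction of the three finiteness
hypotheses; the fourth member (critical Morrey quantities `M^{s,l}`, `3/s + 2/l < 2`) is NOT vendored
(no use downstream; it would only enlarge the hypothesis). Translation to a general centre `z` is
the paper's standing convention (all notions are translation invariant), as in
`albrittonBarker2019_lemma_2_5_rate`. The vendored statement is thus a special case of the printed
lemma (weaker hypothesis list), never stronger.

Grounds `Summit.NavierStokesRegularity.NavierStokesRegularity.Theses.StretchingWellBinding.TypeIBridge`
(item stmt-NavierStokesRegularity-1576, steps (4)–(5) of its text: enstrophy at Leray's rate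
`Ω(t) ≤ K(T−t)^{-1/2}` gives `E(Q') ≤ 2K` for every parabolic sub-ball below the blow-up time, "hence
`sup_{Q'} E < ∞` and Albritton–Barker Lemma 2.6 (= Seregin 2006 / 2007 Morrey estimates) ⇒ `𝐈 < ∞`
at a singular point"). The underlying estimates are G. Seregin, *Estimates of suitable weak
solutions to the Navier–Stokes equations in critical Morrey spaces*, Zap. Nauchn. Sem. POMI 336
(2006) = J. Math. Sci. 143 (2007) [SereginCriticalMorrey2006 in A–B's bibliography]; A–B print the
lemma without proof, citing these.

## References

* D. Albritton, T. Barker, J. Math. Fluid Mech. 21 (2019) = arXiv:1811.00502: §1 (`A, C, D, E, 𝐈`),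
  Def. 2.1, Lemma 2.5, **Lemma 2.6**. [AlbrittonBarker2019]
* G. Seregin, J. Math. Sci. 143 (2007) 2961–2968 (Morrey-space estimates for suitable weak
  solutions), the source A–B cite for Lemma 2.6.
-/

noncomputable section

open MeasureTheory Set Metric
open scoped ENNReal NNReal

namespace Literature.Analysis.FluidPDE

/-- Local notation for physical space `ℝ³ = EuclideanSpace ℝ (Fin 3)`. -/
local notation "ℝ³" => EuclideanSpace ℝ (Fin 3)

/-- **Albritton–Barker 2019, Lemma 2.6 (Morrey-type estimates), rescaled-energy cases.** If
`(u, p)` is a suitable weak solution of Navier–Stokes (`ν = 1`, `f = 0`) in the parabolic ball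
`Q(z, 1) = ]t−1, t[ × B(x, 1)`, `z = (t, x)` (A–B Def. 2.1), `G` is a weak spatial gradient of `u`
there, and ONE of the scaled energies is bounded uniformly over all parabolic sub-balls
`Q(z', r) ⊆ Q(z, 1)`: `sup A(Q(z',r)) < ∞` (essential-sup form `cknAEss`), or `sup C(Q(z',r)) < ∞`,
or `sup E(Q(z',r)) < ∞` (with `∇u := G`), then for every `0 < R < 1` Albritton–Barker's Type I
quantity of the smaller ball is finite: `𝐈(Q(z, R)) = typeIBound (Q(z,R)) u p G < ∞`. Printed for
`z = 0` with a fourth admissible member `sup M^{s,l}` of the minimum (critical Morrey quantities,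
not vendored); proof in Seregin 2006/2007 (A–B cite it). Grounds
`Summit.NavierStokesRegularity.NavierStokesRegularity.Theses.StretchingWellBinding.TypeIBridge`
(the `E`-case). [cite: AlbrittonBarker2019, Lemma 2.6 (arXiv:1811.00502 §2)] -/
def albrittonBarker2019_lemma_2_6 : Prop :=
  ∀ (z : ℝ × ℝ³) (u : ℝ → ℝ³ → ℝ³) (p : ℝ → ℝ³ → ℝ),
    IsSuitableWeakSolutionInBall 1 z u p →
    ∀ G : ℝ → ℝ³ → ℝ³ →L[ℝ] ℝ³,
      FluidPDE.HasWeakSpatialGradientOn (FluidPDE.parabolicCylinderOpens 1 z) u G →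
      ((⨆ (r : ℝ) (_ : 0 < r) (z' : ℝ × ℝ³)
          (_ : FluidPDE.parabolicCylinder r z' ⊆ FluidPDE.parabolicCylinder 1 z), cknAEss r z' u) < ∞ ∨
        (⨆ (r : ℝ) (_ : 0 < r) (z' : ℝ × ℝ³)
          (_ : FluidPDE.parabolicCylinder r z' ⊆ FluidPDE.parabolicCylinder 1 z),
            FluidPDE.cknC r z' u) < ∞ ∨
        (⨆ (r : ℝ) (_ : 0 < r) (z' : ℝ × ℝ³)
          (_ : FluidPDE.parabolicCylinder r z' ⊆ FluidPDE.parabolicCylinder 1 z),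
            FluidPDE.cknE r z' G) < ∞) →
      ∀ R : ℝ, 0 < R → R < 1 → typeIBound (FluidPDE.parabolicCylinder R z) u p G < ∞

/-- The `E`-case of the fact in the form route StretchingWellBinding consumes it: a uniform bound
`E(Q(z', r)) ≤ M` on every parabolic sub-ball of `Q(z, 1)` gives `𝐈(Q(z, 1/2)) < ∞`.
[cite: AlbrittonBarker2019, Lemma 2.6 (arXiv:1811.00502 §2)] -/
theorem albrittonBarker2019_lemma_2_6.of_cknE_le (h : albrittonBarker2019_lemma_2_6)
    {z : ℝ × ℝ³} {u : ℝ → ℝ³ → ℝ³} {p : ℝ → ℝ³ → ℝ} (hsw : IsSuitableWeakSolutionInBall 1 z u p)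
    {G : ℝ → ℝ³ → ℝ³ →L[ℝ] ℝ³}
    (hG : FluidPDE.HasWeakSpatialGradientOn (FluidPDE.parabolicCylinderOpens 1 z) u G) {M : ℝ≥0}
    (hE : ∀ (r : ℝ) (z' : ℝ × ℝ³), 0 < r →
      FluidPDE.parabolicCylinder r z' ⊆ FluidPDE.parabolicCylinder 1 z → FluidPDE.cknE r z' G ≤ M) :
    typeIBound (FluidPDE.parabolicCylinder (1 / 2) z) u p G < ∞ := by
  refine h z u p hsw G hG (Or.inr (Or.inr ?_)) (1 / 2) (by norm_num) (by norm_num)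
  refine lt_of_le_of_lt ?_ (ENNReal.coe_lt_top (r := M))
  refine iSup_le fun r => iSup_le fun hr => iSup_le fun z' => iSup_le fun hz' => ?_
  exact hE r z' hr hz'

end Literature.Analysis.FluidPDE

end
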